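import Summits.AnomalousDissipation.AnomalousDissipation.Theorems.SolenoidalFractalHomogenisationLagrangianStepCellChainPair
import Summits.AnomalousDissipation.AnomalousDissipation.Theorems.SolenoidalFractalHomogenisationLagrangianStepCellChainModesFrame
import Literature.Analysis.FluidPDE.PassiveVectorTensorDistortedConstFrameGalerkinIdentity
import HarnessLib

/-!
# K1L_D (stmt-AnomalousDissipation-27980), (ℓ3) (D-TH)₀ — W7 engine sub-piece S1a AT A FROZEN FRAME `G₀`: the CONJUGATE-PAIR DISSIPATION SPLIT
# of a distorted weak solution (hypothesis (H2)/`hQ` of `W7Slot.slot_stepR`, multiplicity `2`) (helper; `--supports stmt-AnomalousDissipation-27980 --as helper`)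

Port plan B8 (`HOME/ad-sawtooth-k1loc-p1/g16/W7thg-portplan-k1locp1g16.md`; prover ad-sawtooth-k1loc-p1 g16): the frozen-frame twin of w1's flat
`…CellChainPair` §3.  §1–§2 of the flat file (`symb_neg_left/right`, `re_inner_symbT_neg_conj`, `norm_gauge`, `norm_zpow_gauge_smul`,
`re_inner_symbT_zpow_gauge_smul`, `block_split_le`, `norm_mFourierCoeff_neg`) are generic in the tensor and reused BY NAME with the conjugated tensor
`𝔹^{G₀} = Visc4.conj G₀ 𝔹`; what changes is the class (`IsWeakTensorPassiveVectorDistortedOn … (fun _ _ => G₀)`: twisted transversality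
`rdot (G₀ᵀk) û(k) = 0`, Literature `ae_rdot_twistFreq_mFourierCoeff_eq_zero`), the damping `ỹ = 4π² • P^θ_K T_{(𝔹^{G₀})ᵀ}(K) w̃` and the coercivity,
taken here as an a.e. HYPOTHESIS `loc·|k|²‖û(k)‖² ≤ Re⟪û(k), T_{𝔹^{G₀}}(k) û(k)⟫` (supplied by w1's `exists_energyRep_cell_frame` with `loc = lo'·c₀`,
`c₀|k|² ≤ |G₀ᵀk|²` the frame non-degeneracy).
* `re_inner_twistAdjGen` — `Re⟪4π² • P^θ_K T_{(𝔹^{G₀})ᵀ}(K) w, w⟫ = 4π² Re⟪w, T_{𝔹^{G₀}}(K) w⟫` for `rdot (G₀ᵀK) w = 0`;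
* **`ae_pair_dissipation_split_frame`**, `ae_pair_dissipation_split_rep_frame` (on the representatives `modeRepθ`).
Everything proved; no definitions, no named facts, no sorry.  NOT a proof of `stub_W7thg`, of K1L_D or of AD; rung F-D1.A0 infrastructure.
[cite: BedrossianCotiZelati2017, §2 (hypocoercivity functional with a cross term)] [problem: turb]
-/

set_option linter.dupNamespace false

noncomputable section

namespace Summit.AnomalousDissipation.AnomalousDissipation.Theorems.SolenoidalFractalHomogenisation.LagrangianStep.CellChain

open Set MeasureTheory Filter Topology Function Complex UnitAddTorus
open scoped InnerProductSpace ComplexConjugate ENNReal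
open Literature.Analysis Literature.Analysis.FunctionSpaces Literature.Analysis.FunctionSpaces.Torus
open Literature.Analysis.FluidPDE Literature.Analysis.FluidPDE.Torus Literature.Analysis.FluidPDE.LatticeShear
open Summit.AnomalousDissipation.AnomalousDissipation.Theorems.SolenoidalFractalHomogenisation.RealisedQuasiStaticCellLaw

variable {k₀ : ℕ}

/-- **The twisted hypocoercivity damping pairs like the conjugated symbol form**: for `rdot (G₀ᵀK) w = 0`,
`Re⟪4π² • P^θ_K T_{(𝔹^{G₀})ᵀ}(K) w, w⟫ = 4π² Re⟪w, T_{𝔹^{G₀}}(K) w⟫`. [cite: Frisch1995Turbulence, §9.6.3 eq. (9.57) p. 233] -/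
theorem re_inner_twistAdjGen (𝔹 : Torus.Visc4 (Fin 3)) (G₀ : Matrix (Fin 3) (Fin 3) ℝ) (K : Fin 3 → ℤ) {w : EuclideanSpace ℂ (Fin 3)}
    (hw : Torus.rdot (Torus.twistFreq G₀ K) w = 0) :
    (⟪((4 * Real.pi ^ 2 : ℝ) : ℂ) • Torus.transversalProjR (Torus.twistFreq G₀ K) (Torus.symbT (Torus.majorTranspose (Torus.Visc4.conj G₀ 𝔹)) K w), w⟫_ℂ).re =
      4 * Real.pi ^ 2 * (⟪w, Torus.symbT (Torus.Visc4.conj G₀ 𝔹) K w⟫_ℂ).re := by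
  rw [inner_smul_left, Torus.inner_transversalProjR_left_of_rdot_eq_zero _ hw, Torus.inner_symbT_majorTranspose_left,
    Complex.conj_ofReal, Complex.re_ofReal_mul]

/-- **THE CONJUGATE-PAIR DISSIPATION SPLIT, FROZEN FRAME** (hypothesis `hQ` of `W7Slot.slot_stepR`, multiplicity `2`).  Let `u` be a distorted weak
solution with tensor `𝔹` at the constant frame `G₀`, `E, Q` with `E t = ∫‖u t‖²` a.e. and the finite-block bounds of the CONJUGATED symbol form
`4π² Σ_{k∈S} Re⟪û, T_{𝔹^{G₀}}(k) û⟫ ≤ Q`, a.e. coercivity `loc·|k|²‖û(k)‖² ≤ Re⟪û(k), T_{𝔹^{G₀}}(k) û(k)⟫`, a slow chain `Kⱼ = K₀ + j·K_s`, `|j| ≤ 2`,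
`K_s ≠ 0`, the `+`/`−` windows disjoint, the gauge `μ = σ·conj e^{iφ}` (`σ = ±1`), and `0 ≤ dmin ≤ 8π²·loc·|k|²` on every other mode the solution
carries.  Then for a.e. `t ∈ (0,T)`, with `w̃ⱼ = μ^j • û(t)(Kⱼ)` and `ỹⱼ = 4π² • P^θ_{Kⱼ} T_{(𝔹^{G₀})ᵀ}(Kⱼ) w̃ⱼ`:
`2·Σⱼ Re⟪ỹⱼ, w̃ⱼ⟫ + (dmin/2)·(E t − 2·Σⱼ ‖w̃ⱼ‖²) ≤ Q t`. [cite: BedrossianCotiZelati2017, §2 (hypocoercivity functional with a cross term)] -/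
theorem ae_pair_dissipation_split_frame {T : ℝ} {𝔹 : Torus.Visc4 (Fin 3)} {G₀ : Matrix (Fin 3) (Fin 3) ℝ}
    {b u : ℝ → UnitAddTorus (Fin 3) → EuclideanSpace ℝ (Fin 3)}
    {F : UnitAddTorus (Fin 3) → EuclideanSpace ℝ (Fin 3)} (h : Torus.IsWeakTensorPassiveVectorDistortedOn 0 T 𝔹 b (fun _ _ => G₀) F u) {loc : ℝ}
    {E Q : ℝ → ℝ}
    (hE : ∀ᵐ t ∂(volume.restrict (Ioo 0 T)), E t = ∫ x, ‖u t x‖ ^ 2)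
    (hQ : ∀ᵐ t ∂(volume.restrict (Ioo 0 T)), ∀ S : Finset (Fin 3 → ℤ),
      4 * Real.pi ^ 2 * ∑ k ∈ S, (⟪mFourierCoeff (EuclideanSpace.complexify ∘ u t) k,
        Torus.symbT (Torus.Visc4.conj G₀ 𝔹) k (mFourierCoeff (EuclideanSpace.complexify ∘ u t) k)⟫_ℂ).re ≤ Q t)
    (hcoer : ∀ᵐ t ∂(volume.restrict (Ioo 0 T)), ∀ k : Fin 3 → ℤ,
      loc * (freqNormSq k * ‖mFourierCoeff (EuclideanSpace.complexify ∘ u t) k‖ ^ 2) ≤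
        (⟪mFourierCoeff (EuclideanSpace.complexify ∘ u t) k, Torus.symbT (Torus.Visc4.conj G₀ 𝔹) k (mFourierCoeff (EuclideanSpace.complexify ∘ u t) k)⟫_ℂ).re)
    (K0 Ks : Fin 3 → ℤ) (hKs : Ks ≠ 0)
    (hdisj : ∀ j ∈ ({-2, -1, 0, 1, 2} : Finset ℤ), ∀ j' ∈ ({-2, -1, 0, 1, 2} : Finset ℤ), K0 + j • Ks ≠ -(K0 + j' • Ks))
    {σ : ℝ} (hσ : σ = 1 ∨ σ = -1) (φ : ℝ) {dmin : ℝ} (hdmin : 0 ≤ dmin)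
    (hgap : ∀ᵐ t ∂(volume.restrict (Ioo 0 T)), ∀ k : Fin 3 → ℤ,
      (∀ j ∈ ({-2, -1, 0, 1, 2} : Finset ℤ), k ≠ K0 + j • Ks ∧ k ≠ -(K0 + j • Ks)) → mFourierCoeff (EuclideanSpace.complexify ∘ u t) k ≠ 0 →
      dmin ≤ 8 * Real.pi ^ 2 * loc * freqNormSq k) :
    ∀ᵐ t ∂(volume.restrict (Ioo 0 T)),
      2 * ∑ j ∈ ({-2, -1, 0, 1, 2} : Finset ℤ),
          (⟪((4 * Real.pi ^ 2 : ℝ) : ℂ) • Torus.transversalProjR (Torus.twistFreq G₀ (K0 + j • Ks))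
              (Torus.symbT (Torus.majorTranspose (Torus.Visc4.conj G₀ 𝔹)) (K0 + j • Ks)
                (((σ : ℂ) * starRingEnd ℂ (Complex.exp (φ * Complex.I))) ^ j • mFourierCoeff (EuclideanSpace.complexify ∘ u t) (K0 + j • Ks))),
            ((σ : ℂ) * starRingEnd ℂ (Complex.exp (φ * Complex.I))) ^ j • mFourierCoeff (EuclideanSpace.complexify ∘ u t) (K0 + j • Ks)⟫_ℂ).re +
        dmin / 2 * (E t - 2 * ∑ j ∈ ({-2, -1, 0, 1, 2} : Finset ℤ), ‖((σ : ℂ) * starRingEnd ℂ (Complex.exp (φ * Complex.I))) ^ j • mFourierCoeff (EuclideanSpace.complexify ∘ u t) (K0 + j • Ks)‖ ^ 2) ≤ Q t := by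
  classical
  set S5 : Finset ℤ := ({-2, -1, 0, 1, 2} : Finset ℤ) with hS5
  filter_upwards [hE, hQ, hgap, h.ae_rdot_twistFreq_mFourierCoeff_eq_zero, hcoer, h.ae_memLp_two, h.ae_integrable_slice]
    with t hEt hQt hgapt htrt hcoert h2 hint
  -- notation at time `t`
  set Xt : (Fin 3 → ℤ) → EuclideanSpace ℂ (Fin 3) := fun k => mFourierCoeff (EuclideanSpace.complexify ∘ u t) k with hXt
  have hkdot : ∀ k, Torus.rdot (Torus.twistFreq G₀ k) (Xt k) = 0 := fun k => htrt k
  -- injectivity of the two parametrisations and disjointness of the windows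
  have hinj : Set.InjOn (fun j : ℤ => K0 + j • Ks) ↑S5 := by
    intro j _ j' _ hjj'
    have h1 : (j - j') • Ks = 0 := by rw [sub_zsmul]; exact sub_eq_zero.2 (add_left_cancel hjj')
    rcases smul_eq_zero.1 h1 with h | h
    · exact sub_eq_zero.1 h
    · exact absurd h hKs
  have hinj' : Set.InjOn (fun j : ℤ => -(K0 + j • Ks)) ↑S5 := fun j hj j' hj' hjj' => hinj hj hj' (neg_injective hjj')
  set W : Finset (Fin 3 → ℤ) := S5.image (fun j : ℤ => K0 + j • Ks) ∪ S5.image (fun j : ℤ => -(K0 + j • Ks)) with hW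
  have hWdisj : Disjoint (S5.image (fun j : ℤ => K0 + j • Ks)) (S5.image (fun j : ℤ => -(K0 + j • Ks))) := by
    rw [Finset.disjoint_left]
    intro k hk hk'
    rw [Finset.mem_image] at hk hk'
    obtain ⟨j, hj, rfl⟩ := hk
    obtain ⟨j', hj', hjj'⟩ := hk'
    exact hdisj j hj j' hj' hjj'.symm
  have hnotW : ∀ k, k ∉ W → ∀ j ∈ S5, k ≠ K0 + j • Ks ∧ k ≠ -(K0 + j • Ks) := by
    intro k hk j hj
    rw [hW, Finset.mem_union, not_or, Finset.mem_image, Finset.mem_image, not_exists, not_exists] at hk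
    exact ⟨fun e => hk.1 j ⟨hj, e.symm⟩, fun e => hk.2 j ⟨hj, e.symm⟩⟩
  -- the fixed-time split on the ten-mode block `W`
  have hpars : HasSum (fun k => ‖Xt k‖ ^ 2) (E t) := by rw [hEt]; exact hasSum_sq_norm_mFourierCoeff_complexify h2
  have hsplit := block_split_le hdmin hpars hQt hcoert W (fun k hk hX => hgapt k (hnotW k hk) hX)
  -- fold the block sums: reality + gauge
  have hsumW : ∀ f : (Fin 3 → ℤ) → ℝ, (∀ k, f (-k) = f k) → ∑ k ∈ W, f k = 2 * ∑ j ∈ S5, f (K0 + j • Ks) := by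
    intro f hf
    rw [hW, Finset.sum_union hWdisj, Finset.sum_image hinj, Finset.sum_image hinj', two_mul]
    congr 1
    exact Finset.sum_congr rfl fun j _ => hf _
  have hnorm : ∑ k ∈ W, ‖Xt k‖ ^ 2 = 2 * ∑ j ∈ S5, ‖((σ : ℂ) * starRingEnd ℂ (Complex.exp (φ * Complex.I))) ^ j • Xt (K0 + j • Ks)‖ ^ 2 := by
    rw [hsumW (fun k => ‖Xt k‖ ^ 2) (fun k => by simp only [hXt]; rw [norm_mFourierCoeff_neg hint.1])]
    congr 1
    exact Finset.sum_congr rfl fun j _ => by rw [norm_zpow_gauge_smul hσ]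
  have hdiss : 4 * Real.pi ^ 2 * ∑ k ∈ W, (⟪Xt k, Torus.symbT (Torus.Visc4.conj G₀ 𝔹) k (Xt k)⟫_ℂ).re =
      2 * ∑ j ∈ S5, (⟪((4 * Real.pi ^ 2 : ℝ) : ℂ) • Torus.transversalProjR (Torus.twistFreq G₀ (K0 + j • Ks))
          (Torus.symbT (Torus.majorTranspose (Torus.Visc4.conj G₀ 𝔹)) (K0 + j • Ks)
            (((σ : ℂ) * starRingEnd ℂ (Complex.exp (φ * Complex.I))) ^ j • Xt (K0 + j • Ks))),
        ((σ : ℂ) * starRingEnd ℂ (Complex.exp (φ * Complex.I))) ^ j • Xt (K0 + j • Ks)⟫_ℂ).re := by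
    rw [hsumW (fun k => (⟪Xt k, Torus.symbT (Torus.Visc4.conj G₀ 𝔹) k (Xt k)⟫_ℂ).re) (fun k => by
      simp only [hXt]
      exact re_inner_symbT_neg_conj (Torus.Visc4.conj G₀ 𝔹) k (fun i => FunctionSpaces.Torus.mFourierCoeff_complexify_neg_apply hint.1 k i)),
      ← mul_assoc, mul_comm (4 * Real.pi ^ 2) 2, mul_assoc, Finset.mul_sum]
    congr 1
    refine Finset.sum_congr rfl fun j _ => ?_
    rw [re_inner_twistAdjGen _ _ _ (by rw [map_smul, hkdot, smul_zero]), re_inner_symbT_zpow_gauge_smul hσ]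
  rw [hnorm, hdiss] at hsplit
  exact hsplit

/-- **The conjugate-pair dissipation split, frozen frame, cell form on the continuous representatives** (`modeRepθ`, all modes agreeing with their
representatives a.e. by `ae_forall_eq_modeRepθ`). [cite: BedrossianCotiZelati2017, §2 (hypocoercivity functional with a cross term)] -/
theorem ae_pair_dissipation_split_rep_frame {k₀ : ℕ} (W₁ : LatticeWord k₀) (n : ℕ) {T : ℝ} (hT : 0 ≤ T) {𝔹 : Torus.Visc4 (Fin 3)}
    {G₀ : Matrix (Fin 3) (Fin 3) ℝ}
    {F : UnitAddTorus (Fin 3) → EuclideanSpace ℝ (Fin 3)} {u : ℝ → UnitAddTorus (Fin 3) → EuclideanSpace ℝ (Fin 3)}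
    (h : Torus.IsWeakTensorPassiveVectorDistortedOn 0 T 𝔹 (W₁.cell n) (fun _ _ => G₀) F u) (hF : Integrable F volume) {loc : ℝ}
    {E Q : ℝ → ℝ}
    (hE : ∀ᵐ t ∂(volume.restrict (Ioo 0 T)), E t = ∫ x, ‖u t x‖ ^ 2)
    (hQ : ∀ᵐ t ∂(volume.restrict (Ioo 0 T)), ∀ S : Finset (Fin 3 → ℤ),
      4 * Real.pi ^ 2 * ∑ k ∈ S, (⟪mFourierCoeff (EuclideanSpace.complexify ∘ u t) k,
        Torus.symbT (Torus.Visc4.conj G₀ 𝔹) k (mFourierCoeff (EuclideanSpace.complexify ∘ u t) k)⟫_ℂ).re ≤ Q t)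
    (hcoer : ∀ᵐ t ∂(volume.restrict (Ioo 0 T)), ∀ k : Fin 3 → ℤ,
      loc * (freqNormSq k * ‖mFourierCoeff (EuclideanSpace.complexify ∘ u t) k‖ ^ 2) ≤
        (⟪mFourierCoeff (EuclideanSpace.complexify ∘ u t) k, Torus.symbT (Torus.Visc4.conj G₀ 𝔹) k (mFourierCoeff (EuclideanSpace.complexify ∘ u t) k)⟫_ℂ).re)
    (K0 Ks : Fin 3 → ℤ) (hKs : Ks ≠ 0)
    (hdisj : ∀ j ∈ ({-2, -1, 0, 1, 2} : Finset ℤ), ∀ j' ∈ ({-2, -1, 0, 1, 2} : Finset ℤ), K0 + j • Ks ≠ -(K0 + j' • Ks))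
    {σ : ℝ} (hσ : σ = 1 ∨ σ = -1) (φ : ℝ) {dmin : ℝ} (hdmin : 0 ≤ dmin)
    (hgap : ∀ᵐ t ∂(volume.restrict (Ioo 0 T)), ∀ k : Fin 3 → ℤ,
      (∀ j ∈ ({-2, -1, 0, 1, 2} : Finset ℤ), k ≠ K0 + j • Ks ∧ k ≠ -(K0 + j • Ks)) → mFourierCoeff (EuclideanSpace.complexify ∘ u t) k ≠ 0 →
      dmin ≤ 8 * Real.pi ^ 2 * loc * freqNormSq k) :
    ∀ᵐ t ∂(volume.restrict (Ioo 0 T)),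
      2 * ∑ j ∈ ({-2, -1, 0, 1, 2} : Finset ℤ),
          (⟪((4 * Real.pi ^ 2 : ℝ) : ℂ) • Torus.transversalProjR (Torus.twistFreq G₀ (K0 + j • Ks))
              (Torus.symbT (Torus.majorTranspose (Torus.Visc4.conj G₀ 𝔹)) (K0 + j • Ks)
                (((σ : ℂ) * starRingEnd ℂ (Complex.exp (φ * Complex.I))) ^ j • modeRepθ W₁ n 𝔹 G₀ F u (K0 + j • Ks) t)),
            ((σ : ℂ) * starRingEnd ℂ (Complex.exp (φ * Complex.I))) ^ j • modeRepθ W₁ n 𝔹 G₀ F u (K0 + j • Ks) t⟫_ℂ).re +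
        dmin / 2 * (E t - 2 * ∑ j ∈ ({-2, -1, 0, 1, 2} : Finset ℤ), ‖((σ : ℂ) * starRingEnd ℂ (Complex.exp (φ * Complex.I))) ^ j • modeRepθ W₁ n 𝔹 G₀ F u (K0 + j • Ks) t‖ ^ 2) ≤ Q t := by
  filter_upwards [ae_pair_dissipation_split_frame h hE hQ hcoer K0 Ks hKs hdisj hσ φ hdmin hgap, ae_forall_eq_modeRepθ W₁ n hT h hF]
    with t ht hrep
  simp only [← hrep]
  exact ht

end Summit.AnomalousDissipation.AnomalousDissipation.Theorems.SolenoidalFractalHomogenisation.LagrangianStep.CellChain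

end
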